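import Literature.AlgebraicGeometry.Modules.CechFullCochainRawDegreeTwo
import Literature.AlgebraicGeometry.Morphisms.CechModuleUnitH2Pullback
import HarnessLib

/-!
# The raw reading of full Čech cochains of `𝒪_X` in degrees `1, 2`: a bijection compatible with sums, scalars, the
# differential and cocycles (The Stacks Project, Tags 01ED, 01FG; Görtz–Wedhorn II, Def. 21.64 / 21.68)

Topic `AlgebraicGeometry/Modules`; namespace `Literature.AlgebraicGeometry.Modules`.  THEOREMS ONLY (no `def`, no instance, no
notation, no named fact, no `sorry`).  Cell `hodgecm-mathlib` FLOOR 0, P1 sub-line F-11, MONO-G1 slot (5) `hrel₃`, road (R109) of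
F0P1b-plan (g2): piece **N3′ DICTIONARY COMPAT, FILE 1** — sequel of ★ `Modules/CechFullCochainRawDegreeTwo` (F0P1b-p03 (g2)),
consumed by the assembly N4 (F0P1b-p04 (g2)) which carries the ordered∕full identity `[2]^* = 4` on `Ȟ²(𝒪)` (N1) down to a
letter written in the raw currency of ★ `Morphisms/CechModuleH2` (`CechMC2`, `cechMD1`, `cechMZ2`, `cechMB2`).

For a scheme `X`, an `A`-structure `f : X ⟶ Spec A` (raw side, ★ `Morphisms/CechModule`) resp. `ρ : A → Γ(X, 𝒪_X)` (full side,
★ `Modules.sectionsSystem 𝓤 (unitModule X) ρ =: S`) and a linearly ordered family of opens `𝓤 = (U_i)_{i ∈ ι}`, a FULL `2`-cochain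
`c ∈ Full.Cochain S 2 = Π_{α : Fin 3 → ι} Γ(𝒪_X, U_{ {α} })` (★ `Algebra/Homology/OrderedCechSystemFull`) has the **raw reading**
(token `rawTwo` in names) `(j,l,m) ↦ c(j,l,m)|_{U_j ∩ U_l ∩ U_m} ∈ CechMC2 f 𝒪 𝓤` — restriction along the EQUALITY of opens
`U_j ∩ U_l ∩ U_m = U_{ {j,l,m} }` spelled with ★ `inf_le_cechOpen_triple`; ★ `CechFullCochainRawDegreeTwo` uses the inverse
transport `hc : ∀ α, c α = s(α₀,α₁,α₂)|_{U_{ {α} }}`.  This file proves: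

* §1 the reading is a bijection `Full.Cochain S 2 ≃ CechMC2 f 𝒪 𝓤` (and in degree `1`): `eq_of_rawTwo_eq`, `exists_rawTwo_eq`, and
  `forall_toRing_eq_iff_forall_rawTwo_eq` (the two transports are inverse to each other);
* §2 it is additive and compatible with scalars: `rawTwo_sub`, `rawTwo_zsmul`, `rawTwo_nsmul`, and **`rawTwo_smul`** for the
  `A`-actions (through `ρ` on the full side, through `f` on the raw side) when `ρ = algebraMapΓ f` — for `X : Over (Spec k)`,
  `ρ = scalarRingHomTop X`, `f = X.hom` this hypothesis is `rfl` pointwise; the same in the `hc` convention (`toRing_sub_eq`, …);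
* §3 **`map_toRing_d_one_eq_cechMD1`** ∕ **`toRing_full_d_one_two`** — the reading of `(Full.complex S).d 1 2 w` is `cechMD1` of the
  reading of `w` [StacksProject, Tag 01FG]; hence **`mem_cechMB2_of_eq_full_d`** ∕ `mem_cechMB2_of_forall_toRing_eq_of_full_d_eq`:
  a raw `2`-cochain read by a full `2`-coboundary is a raw `2`-coboundary;
* §4 cocycles both ways: `full_d_two_eq_zero_of_mem_cechMZ2` (also in the `hc` convention), `mem_cechMZ2_of_full_d_two_eq_zero`.

FILE 2 (`Modules/CechFullCochainRawPullbackCompat`) reads ★ `Full.pullbackCochain θ (pullbackSystemHom g …)` as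
`cechMRefineC2 θ ∘ cechComapC2 g`.  Mathlib (pin v4.32) has no Čech cohomology of schemes; everything here is restriction along
equal opens over ★ files.  HC_CM is proved only modulo the 7 printed citations until rung 0 closes; nothing here refers to it.

## References
* The Stacks Project, Tag 01ED (Čech complex of `𝒪_X`), Tag 01FG (all tuples). [StacksProject]
* U. Görtz, T. Wedhorn, *Algebraic Geometry II: Cohomology of Schemes* (2023), Def. 21.64 (p. 179), Def. 21.68 (p. 180). [GortzWedhorn2023]
-/

noncomputable section

open CategoryTheory AlgebraicGeometry TopologicalSpace Opposite
open Literature.Algebra.Homology Literature.Algebra.Homology.OrderedCech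
open Literature.AlgebraicGeometry.Morphisms

set_option backward.isDefEq.respectTransparency false -- `ModuleCat`-valued functors (as in ★ `OrderedCechSystemFull`)

universe u

namespace Literature.AlgebraicGeometry.Modules

/-! ## §0 Plumbing: tuples, opens, restrictions -/

section Plumbing

variable {X : Scheme.{u}} {ι : Type} [LinearOrder ι] (U : ι → X.Opens) {A : Type u} [CommRing A] (ρ : A →+* Γ(X, ⊤))

omit [LinearOrder ι] in
/-- A `2`-tuple is the triple of its entries. [cite: StacksProject, Tag 01FG] -/
theorem vecCons₃_apply_eq (α : Fin (2 + 1) → ι) : (![α 0, α 1, α 2] : Fin (2 + 1) → ι) = α := by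
  funext k; fin_cases k <;> rfl

omit [LinearOrder ι] in
/-- A `1`-tuple is the pair of its entries. [cite: StacksProject, Tag 01FG] -/
theorem vecCons₂_apply_eq (α : Fin (1 + 1) → ι) : (![α 0, α 1] : Fin (1 + 1) → ι) = α := by
  funext k; fin_cases k <;> rfl

/-- `U_{ {α} } ≤ U_{α 0} ∩ U_{α 1}` for a `1`-tuple. [cite: GortzWedhorn2023, Def. 21.64 (p. 179)] -/
theorem cechOpen_image_le_inf₂ (α : Fin (1 + 1) → ι) : cechOpen U (Finset.univ.image α) ≤ U (α 0) ⊓ U (α 1) :=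
  le_inf (cechOpen_image_le_apply U α 0) (cechOpen_image_le_apply U α 1)

/-- Composite restrictions of functions (plumbing). [folklore] -/
private theorem resFun_comp {U₁ U₂ U₃ : X.Opens} (h₁ : U₂ ≤ U₁) (h₂ : U₃ ≤ U₂) (x : Γ(X, U₁)) :
    X.presheaf.map (homOfLE h₂).op (X.presheaf.map (homOfLE h₁).op x) = X.presheaf.map (homOfLE (h₂.trans h₁)).op x := by
  rw [← CommRingCat.comp_apply, ← Functor.map_comp]
  rfl

/-- Restriction along `V ≤ W ≤ V` is the identity (plumbing). [folklore] -/
private theorem resFun_comp_self {V W : X.Opens} (h₁ : W ≤ V) (h₂ : V ≤ W) (x : Γ(X, V)) :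
    X.presheaf.map (homOfLE h₂).op (X.presheaf.map (homOfLE h₁).op x) = x := by
  rw [resFun_comp h₁ h₂]
  have : homOfLE (h₂.trans h₁ : V ≤ V) = 𝟙 V := rfl
  rw [this, op_id, X.presheaf.map_id]
  rfl

omit [LinearOrder ι] in
/-- Restriction along `V ≤ V` is the identity (plumbing). [folklore] -/
private theorem resFun_self {V : X.Opens} (x : Γ(X, V)) : X.presheaf.map (homOfLE (le_refl V)).op x = x := by
  have : homOfLE (le_refl V) = 𝟙 V := rfl
  rw [this, op_id, X.presheaf.map_id]
  rfl

omit [LinearOrder ι] in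
/-- Restriction to a smaller open is injective on sections over an EQUAL open (both inclusions hold). [folklore] -/
private theorem resFun_injective_of_le {V W : X.Opens} (h₁ : W ≤ V) (h₂ : V ≤ W) {x y : Γ(X, V)}
    (h : X.presheaf.map (homOfLE h₁).op x = X.presheaf.map (homOfLE h₁).op y) : x = y := by
  rw [← resFun_comp_self (X := X) h₁ h₂ x, ← resFun_comp_self (X := X) h₁ h₂ y, h]

omit [LinearOrder ι] in
/-- `toRing` as an additive map: integer multiples. [cite: GortzWedhorn2023, Def. 21.68 (p. 180)] -/
theorem SecMod.toRing_zsmul {V : X.Opens} (n : ℤ) (x : SecMod (unitModule X) ρ V) : SecMod.toRing ρ (n • x) = n • SecMod.toRing ρ x :=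
  map_zsmul (⟨⟨SecMod.toRing ρ, SecMod.toRing_zero ρ⟩, SecMod.toRing_add ρ⟩ : SecMod (unitModule X) ρ V →+ Γ(X, V)) n x

omit [LinearOrder ι] in
/-- `toRing` as an additive map: natural multiples. [cite: GortzWedhorn2023, Def. 21.68 (p. 180)] -/
theorem SecMod.toRing_nsmul {V : X.Opens} (n : ℕ) (x : SecMod (unitModule X) ρ V) : SecMod.toRing ρ (n • x) = n • SecMod.toRing ρ x :=
  map_nsmul (⟨⟨SecMod.toRing ρ, SecMod.toRing_zero ρ⟩, SecMod.toRing_add ρ⟩ : SecMod (unitModule X) ρ V →+ Γ(X, V)) n x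

end Plumbing

/-! ## §1 The raw reading is a bijection in degrees `2` and `1` -/

section Reading

variable {A : Type u} [CommRing A] {X : Scheme.{u}} (fX : X ⟶ Spec (.of A)) {ι : Type} [LinearOrder ι] (U : ι → X.Opens)
  (ρ : A →+* Γ(X, ⊤))

/-- **A full `2`-cochain is determined by its raw reading** (`U_{ {j,l,m} } = U_j ∩ U_l ∩ U_m`). [cite: StacksProject, Tag 01FG] -/
theorem eq_of_rawTwo_eq (c c' : Full.Cochain (sectionsSystem U (unitModule X) ρ) 2)
    (h : ∀ j l m : ι, X.presheaf.map (homOfLE (inf_le_cechOpen_triple U j l m)).op (SecMod.toRing ρ (c ![j, l, m])) =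
      X.presheaf.map (homOfLE (inf_le_cechOpen_triple U j l m)).op (SecMod.toRing ρ (c' ![j, l, m]))) : c = c' := by
  funext α
  rw [← vecCons₃_apply_eq α]
  exact SecMod.toRing_injective ρ
    (resFun_injective_of_le (X := X) (inf_le_cechOpen_triple U (α 0) (α 1) (α 2)) (cechOpen_image_le_inf₃ U _) (h (α 0) (α 1) (α 2)))

/-- **A full `1`-cochain is determined by its raw reading.** [cite: StacksProject, Tag 01FG] -/
theorem eq_of_rawOne_eq (c c' : Full.Cochain (sectionsSystem U (unitModule X) ρ) 1)
    (h : ∀ j l : ι, X.presheaf.map (homOfLE (inf_le_cechOpen_pair U j l)).op (SecMod.toRing ρ (c ![j, l])) =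
      X.presheaf.map (homOfLE (inf_le_cechOpen_pair U j l)).op (SecMod.toRing ρ (c' ![j, l]))) : c = c' := by
  funext α
  rw [← vecCons₂_apply_eq α]
  exact SecMod.toRing_injective ρ
    (resFun_injective_of_le (X := X) (inf_le_cechOpen_pair U (α 0) (α 1)) (cechOpen_image_le_inf₂ U _) (h (α 0) (α 1)))

/-- **Every raw `2`-cochain is the raw reading of a full `2`-cochain** (namely of `α ↦ s(α₀,α₁,α₂)|_{U_{ {α} }}`).
[cite: StacksProject, Tag 01FG] -/
theorem exists_rawTwo_eq (s : CechMC2 fX (unitModule X) U) :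
    ∃ c : Full.Cochain (sectionsSystem U (unitModule X) ρ) 2,
      ∀ j l m : ι, X.presheaf.map (homOfLE (inf_le_cechOpen_triple U j l m)).op (SecMod.toRing ρ (c ![j, l, m])) = s j l m :=
  ⟨fun α => SecMod.ofRing ρ (X.presheaf.map (homOfLE (cechOpen_image_le_inf₃ U α)).op (s (α 0) (α 1) (α 2))),
    fun j l m => resFun_comp_self (X := X) _ _ (s j l m)⟩

/-- **Every raw `1`-cochain is the raw reading of a full `1`-cochain.** [cite: StacksProject, Tag 01FG] -/
theorem exists_rawOne_eq (s : CechMC1 fX (unitModule X) U) :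
    ∃ c : Full.Cochain (sectionsSystem U (unitModule X) ρ) 1,
      ∀ j l : ι, X.presheaf.map (homOfLE (inf_le_cechOpen_pair U j l)).op (SecMod.toRing ρ (c ![j, l])) = s j l :=
  ⟨fun α => SecMod.ofRing ρ (X.presheaf.map (homOfLE (cechOpen_image_le_inf₂ U α)).op (s (α 0) (α 1))),
    fun j l => resFun_comp_self (X := X) _ _ (s j l)⟩

/-- **The two transports agree (degree `2`)**: a full `2`-cochain `c` is `α ↦ s(α₀,α₁,α₂)|_{U_{ {α} }}` (the hypothesis `hc` of ★
`full_d_eq_zero_of_raw_cocycle` ∕ `exists_raw_sum_cup_of_full`) iff its raw reading is `s`. [cite: StacksProject, Tag 01FG] -/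
theorem forall_toRing_eq_iff_forall_rawTwo_eq (c : Full.Cochain (sectionsSystem U (unitModule X) ρ) 2)
    (s : CechMC2 fX (unitModule X) U) :
    (∀ α : Fin (2 + 1) → ι, SecMod.toRing ρ (c α) =
        X.presheaf.map (homOfLE (cechOpen_image_le_inf₃ U α)).op (s (α 0) (α 1) (α 2))) ↔
      ∀ j l m : ι, X.presheaf.map (homOfLE (inf_le_cechOpen_triple U j l m)).op (SecMod.toRing ρ (c ![j, l, m])) = s j l m := by
  constructor
  · intro h j l m
    rw [h]
    exact resFun_comp_self (X := X) _ _ (s j l m)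
  · intro h α
    rw [← h (α 0) (α 1) (α 2), resFun_comp, ← resFun_self (X := X) (SecMod.toRing ρ (c α))]
    exact map_toRing_apply_congr U ρ c (vecCons₃_apply_eq α).symm _ _

/-- Reading a full `2`-cochain at an arbitrary `2`-tuple `β` is reading it at `(β 0, β 1, β 2)` (unrestricted form of the raw
reading). [cite: StacksProject, Tag 01FG] -/
theorem toRing_eq_map_rawTwo (c : Full.Cochain (sectionsSystem U (unitModule X) ρ) 2) (β : Fin (2 + 1) → ι) :
    SecMod.toRing ρ (c β) = X.presheaf.map (homOfLE (cechOpen_image_le_inf₃ U β)).op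
      (X.presheaf.map (homOfLE (inf_le_cechOpen_triple U (β 0) (β 1) (β 2))).op (SecMod.toRing ρ (c ![β 0, β 1, β 2]))) := by
  rw [resFun_comp, ← resFun_self (X := X) (SecMod.toRing ρ (c β))]
  exact map_toRing_apply_congr U ρ c (vecCons₃_apply_eq β).symm _ _

end Reading

/-! ## §2 Additivity and scalars -/

section Additive

variable {A : Type u} [CommRing A] {X : Scheme.{u}} (fX : X ⟶ Spec (.of A)) {ι : Type} [LinearOrder ι] (U : ι → X.Opens)
  (ρ : A →+* Γ(X, ⊤))

/-- **The raw reading is additive: differences** — if `c`, `c′` read `s`, `s′` then `c − c′` reads `s − s′` (in `Č²(𝓤, 𝒪)` of ★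
`Morphisms/CechModule`). [cite: StacksProject, Tag 01FG] -/
theorem rawTwo_sub (c c' : Full.Cochain (sectionsSystem U (unitModule X) ρ) 2) (s s' : CechMC2 fX (unitModule X) U)
    (hc : ∀ j l m : ι, X.presheaf.map (homOfLE (inf_le_cechOpen_triple U j l m)).op (SecMod.toRing ρ (c ![j, l, m])) = s j l m)
    (hc' : ∀ j l m : ι, X.presheaf.map (homOfLE (inf_le_cechOpen_triple U j l m)).op (SecMod.toRing ρ (c' ![j, l, m])) = s' j l m)
    (j l m : ι) :
    X.presheaf.map (homOfLE (inf_le_cechOpen_triple U j l m)).op (SecMod.toRing ρ ((c - c') ![j, l, m])) = (s - s') j l m := by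
  rw [Pi.sub_apply, SecMod.toRing_sub, map_sub, hc, hc']
  rfl

/-- **The raw reading is additive: integer multiples** (e.g. the `4 • _` of `[2]^* = 4`). [cite: StacksProject, Tag 01FG] -/
theorem rawTwo_zsmul (n : ℤ) (c : Full.Cochain (sectionsSystem U (unitModule X) ρ) 2) (s : CechMC2 fX (unitModule X) U)
    (hc : ∀ j l m : ι, X.presheaf.map (homOfLE (inf_le_cechOpen_triple U j l m)).op (SecMod.toRing ρ (c ![j, l, m])) = s j l m)
    (j l m : ι) :
    X.presheaf.map (homOfLE (inf_le_cechOpen_triple U j l m)).op (SecMod.toRing ρ ((n • c) ![j, l, m])) = (n • s) j l m := by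
  rw [Pi.smul_apply, SecMod.toRing_zsmul, map_zsmul, hc]
  rfl

/-- **The raw reading is additive: natural multiples.** [cite: StacksProject, Tag 01FG] -/
theorem rawTwo_nsmul (n : ℕ) (c : Full.Cochain (sectionsSystem U (unitModule X) ρ) 2) (s : CechMC2 fX (unitModule X) U)
    (hc : ∀ j l m : ι, X.presheaf.map (homOfLE (inf_le_cechOpen_triple U j l m)).op (SecMod.toRing ρ (c ![j, l, m])) = s j l m)
    (j l m : ι) :
    X.presheaf.map (homOfLE (inf_le_cechOpen_triple U j l m)).op (SecMod.toRing ρ ((n • c) ![j, l, m])) = (n • s) j l m := by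
  rw [Pi.smul_apply, SecMod.toRing_nsmul, map_nsmul, hc]
  rfl

/-- **The raw reading is `A`-linear when the two `A`-structures agree** (`ρ = algebraMapΓ f`; for `X : Over (Spec k)` with
`ρ = scalarRingHomTop X`, `f = X.hom` this is `rfl` pointwise): the action through `ρ` on `Γ(𝒪_X, U_{ {α} })` (★ `SecMod`) versus
the action through `f` on `Γ(X, U_j ∩ U_l ∩ U_m)` (★ `MSections`). [cite: GortzWedhorn2023, Def. 21.68 (p. 180)] -/
theorem rawTwo_smul (hρf : ∀ a, ρ a = algebraMapΓ fX a) (a : A) (c : Full.Cochain (sectionsSystem U (unitModule X) ρ) 2)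
    (s : CechMC2 fX (unitModule X) U)
    (hc : ∀ j l m : ι, X.presheaf.map (homOfLE (inf_le_cechOpen_triple U j l m)).op (SecMod.toRing ρ (c ![j, l, m])) = s j l m)
    (j l m : ι) :
    X.presheaf.map (homOfLE (inf_le_cechOpen_triple U j l m)).op (SecMod.toRing ρ ((a • c) ![j, l, m])) = (a • s) j l m := by
  rw [Pi.smul_apply, SecMod.toRing_smul, map_mul, hc, resO_toSections]
  change _ = algebraMap A (Sections fX (U j ⊓ U l ⊓ U m)) a • s j l m
  rw [Sections.algebraMap_apply, ← hρf]
  rfl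

/-- Differences in the `hc` convention of ★ `CechFullCochainRawDegreeTwo`: if `c`, `c′` are the transports of `s`, `s′` then
`c − c′` is the transport of `s − s′`. [cite: StacksProject, Tag 01FG] -/
theorem toRing_sub_eq (c c' : Full.Cochain (sectionsSystem U (unitModule X) ρ) 2) (s s' : CechMC2 fX (unitModule X) U)
    (hc : ∀ α : Fin (2 + 1) → ι, SecMod.toRing ρ (c α) =
      X.presheaf.map (homOfLE (cechOpen_image_le_inf₃ U α)).op (s (α 0) (α 1) (α 2)))
    (hc' : ∀ α : Fin (2 + 1) → ι, SecMod.toRing ρ (c' α) =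
      X.presheaf.map (homOfLE (cechOpen_image_le_inf₃ U α)).op (s' (α 0) (α 1) (α 2)))
    (α : Fin (2 + 1) → ι) :
    SecMod.toRing ρ ((c - c') α) = X.presheaf.map (homOfLE (cechOpen_image_le_inf₃ U α)).op ((s - s') (α 0) (α 1) (α 2)) :=
  (forall_toRing_eq_iff_forall_rawTwo_eq fX U ρ _ _).2
    (rawTwo_sub fX U ρ c c' s s' ((forall_toRing_eq_iff_forall_rawTwo_eq fX U ρ c s).1 hc)
      ((forall_toRing_eq_iff_forall_rawTwo_eq fX U ρ c' s').1 hc')) α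

/-- Integer multiples in the `hc` convention. [cite: StacksProject, Tag 01FG] -/
theorem toRing_zsmul_eq (n : ℤ) (c : Full.Cochain (sectionsSystem U (unitModule X) ρ) 2) (s : CechMC2 fX (unitModule X) U)
    (hc : ∀ α : Fin (2 + 1) → ι, SecMod.toRing ρ (c α) =
      X.presheaf.map (homOfLE (cechOpen_image_le_inf₃ U α)).op (s (α 0) (α 1) (α 2)))
    (α : Fin (2 + 1) → ι) :
    SecMod.toRing ρ ((n • c) α) = X.presheaf.map (homOfLE (cechOpen_image_le_inf₃ U α)).op ((n • s) (α 0) (α 1) (α 2)) :=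
  (forall_toRing_eq_iff_forall_rawTwo_eq fX U ρ _ _).2
    (rawTwo_zsmul fX U ρ n c s ((forall_toRing_eq_iff_forall_rawTwo_eq fX U ρ c s).1 hc)) α

/-- `A`-multiples in the `hc` convention (under `ρ = algebraMapΓ f`). [cite: GortzWedhorn2023, Def. 21.68 (p. 180)] -/
theorem toRing_smul_eq (hρf : ∀ a, ρ a = algebraMapΓ fX a) (a : A) (c : Full.Cochain (sectionsSystem U (unitModule X) ρ) 2)
    (s : CechMC2 fX (unitModule X) U)
    (hc : ∀ α : Fin (2 + 1) → ι, SecMod.toRing ρ (c α) =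
      X.presheaf.map (homOfLE (cechOpen_image_le_inf₃ U α)).op (s (α 0) (α 1) (α 2)))
    (α : Fin (2 + 1) → ι) :
    SecMod.toRing ρ ((a • c) α) = X.presheaf.map (homOfLE (cechOpen_image_le_inf₃ U α)).op ((a • s) (α 0) (α 1) (α 2)) :=
  (forall_toRing_eq_iff_forall_rawTwo_eq fX U ρ _ _).2
    (rawTwo_smul fX U ρ hρf a c s ((forall_toRing_eq_iff_forall_rawTwo_eq fX U ρ c s).1 hc)) α

end Additive

/-! ## §3 The differential `Full 1 → Full 2` reads as `cechMD1`; coboundaries -/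

section Differential

variable {A : Type u} [CommRing A] {X : Scheme.{u}} (fX : X ⟶ Spec (.of A)) {ι : Type} [LinearOrder ι] (U : ι → X.Opens)
  (ρ : A →+* Γ(X, ⊤))

/-- **The raw reading of `d : Full 1 → Full 2` is the raw differential `cechMD1` of the raw reading**:
`(d w)(j,l,m)| = w_{lm}| − w_{jm}| + w_{jl}|` (★ `map_toRing_d_one`) `= (cechMD1 (raw w))_{jlm}`. [cite: StacksProject, Tag 01FG] -/
theorem map_toRing_d_one_eq_cechMD1 (w : Full.Cochain (sectionsSystem U (unitModule X) ρ) 1) (j l m : ι) :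
    X.presheaf.map (homOfLE (inf_le_cechOpen_triple U j l m)).op
        (SecMod.toRing ρ (((Full.complex (sectionsSystem U (unitModule X) ρ)).d 1 2).hom w ![j, l, m])) =
      cechMD1 fX (unitModule X) U
        ((fun j l => X.presheaf.map (homOfLE (inf_le_cechOpen_pair U j l)).op (SecMod.toRing ρ (w ![j, l]))) :
          CechMC1 fX (unitModule X) U) j l m := by
  rw [map_toRing_d_one U ρ w j l m (inf_le_cechOpen_triple U j l m)
      ((le_inf (inf_le_left.trans inf_le_right) inf_le_right : U j ⊓ U l ⊓ U m ≤ U l ⊓ U m).trans (inf_le_cechOpen_pair U l m))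
      ((le_inf (inf_le_left.trans inf_le_left) inf_le_right : U j ⊓ U l ⊓ U m ≤ U j ⊓ U m).trans (inf_le_cechOpen_pair U j m))
      ((inf_le_left : U j ⊓ U l ⊓ U m ≤ U j ⊓ U l).trans (inf_le_cechOpen_pair U j l))]
  simp only [cechMD1_apply, MSections.res_unit, Sections.res_apply]
  rw [resFun_comp, resFun_comp, resFun_comp]

/-- **Unrestricted form**: `(d w)(β) = (cechMD1 w♭)(β 0, β 1, β 2)|_{U_{ {β} }}` with `w♭_{jl} := w(j,l)|_{U_j ∩ U_l}` the raw reading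
of `w` (the `hc` convention of ★ `CechFullCochainRawDegreeTwo` for `c := d w`, `s := cechMD1 w♭`). [cite: StacksProject, Tag 01FG] -/
theorem toRing_full_d_one_two (w : Full.Cochain (sectionsSystem U (unitModule X) ρ) 1) (β : Fin (2 + 1) → ι) :
    SecMod.toRing ρ (((Full.complex (sectionsSystem U (unitModule X) ρ)).d 1 2).hom w β) =
      X.presheaf.map (homOfLE (cechOpen_image_le_inf₃ U β)).op
        (cechMD1 fX (unitModule X) U
          ((fun j l => X.presheaf.map (homOfLE (inf_le_cechOpen_pair U j l)).op (SecMod.toRing ρ (w ![j, l]))) :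
            CechMC1 fX (unitModule X) U) (β 0) (β 1) (β 2)) :=
  (forall_toRing_eq_iff_forall_rawTwo_eq fX U ρ _ _).2 (map_toRing_d_one_eq_cechMD1 fX U ρ w) β

/-- **The raw reading of a full `2`-coboundary `d w` is the raw coboundary `cechMD1 (raw w)`** (as raw `2`-cochains).
[cite: StacksProject, Tag 01FG] -/
theorem rawTwo_eq_cechMD1_of_eq_full_d (w : Full.Cochain (sectionsSystem U (unitModule X) ρ) 1)
    (c : Full.Cochain (sectionsSystem U (unitModule X) ρ) 2)
    (h : ((Full.complex (sectionsSystem U (unitModule X) ρ)).d 1 2).hom w = c) :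
    ((fun j l m => X.presheaf.map (homOfLE (inf_le_cechOpen_triple U j l m)).op (SecMod.toRing ρ (c ![j, l, m]))) :
        CechMC2 fX (unitModule X) U) =
      cechMD1 fX (unitModule X) U
        (fun j l => X.presheaf.map (homOfLE (inf_le_cechOpen_pair U j l)).op (SecMod.toRing ρ (w ![j, l]))) := by
  subst h
  funext j l m
  exact map_toRing_d_one_eq_cechMD1 fX U ρ w j l m

/-- **Hence the raw reading of a full `2`-coboundary lies in `cechMB2`** (the raw `2`-coboundaries of ★ `Morphisms/CechModuleH2`).
[cite: StacksProject, Tag 01FG] -/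
theorem mem_cechMB2_of_eq_full_d (w : Full.Cochain (sectionsSystem U (unitModule X) ρ) 1)
    (c : Full.Cochain (sectionsSystem U (unitModule X) ρ) 2)
    (h : ((Full.complex (sectionsSystem U (unitModule X) ρ)).d 1 2).hom w = c) :
    ((fun j l m => X.presheaf.map (homOfLE (inf_le_cechOpen_triple U j l m)).op (SecMod.toRing ρ (c ![j, l, m]))) :
        CechMC2 fX (unitModule X) U) ∈ cechMB2 fX (unitModule X) U :=
  (mem_cechMB2_iff fX _ U _).2 ⟨_, (rawTwo_eq_cechMD1_of_eq_full_d fX U ρ w c h).symm⟩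

/-- **`hc` convention: a raw `2`-cochain `s` whose transport `c` is a full coboundary `d w` is a raw coboundary**, `s ∈ cechMB2`.
[cite: StacksProject, Tag 01FG] -/
theorem mem_cechMB2_of_forall_toRing_eq_of_full_d_eq (s : CechMC2 fX (unitModule X) U)
    (c : Full.Cochain (sectionsSystem U (unitModule X) ρ) 2)
    (hc : ∀ α : Fin (2 + 1) → ι, SecMod.toRing ρ (c α) =
      X.presheaf.map (homOfLE (cechOpen_image_le_inf₃ U α)).op (s (α 0) (α 1) (α 2)))
    (w : Full.Cochain (sectionsSystem U (unitModule X) ρ) 1)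
    (h : ((Full.complex (sectionsSystem U (unitModule X) ρ)).d 1 2).hom w = c) : s ∈ cechMB2 fX (unitModule X) U := by
  have hs : ((fun j l m => X.presheaf.map (homOfLE (inf_le_cechOpen_triple U j l m)).op (SecMod.toRing ρ (c ![j, l, m]))) :
      CechMC2 fX (unitModule X) U) = s :=
    funext fun j => funext fun l => funext fun m => (forall_toRing_eq_iff_forall_rawTwo_eq fX U ρ c s).1 hc j l m
  rw [← hs]
  exact mem_cechMB2_of_eq_full_d fX U ρ w c h

end Differential

/-! ## §4 Cocycles: `d c = 0` in `Full.complex S` iff the raw reading lies in `cechMZ2` -/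

section Cocycle

variable {A : Type u} [CommRing A] {X : Scheme.{u}} (fX : X ⟶ Spec (.of A)) {ι : Type} [LinearOrder ι] (U : ι → X.Opens)
  (ρ : A →+* Γ(X, ⊤))

/-- **A full `2`-cochain whose raw reading is a raw `2`-cocycle (`∈ cechMZ2`, ★ `Morphisms/CechModuleH2`) is a cocycle of
`Full.complex S`** (★ `full_d_eq_zero_of_raw_cocycle` with the cocycle identity unfolded from `cechMD2 = 0`). [cite: StacksProject, Tag 01FG] -/
theorem full_d_two_eq_zero_of_mem_cechMZ2 (c : Full.Cochain (sectionsSystem U (unitModule X) ρ) 2)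
    (s : CechMC2 fX (unitModule X) U) (hs : s ∈ cechMZ2 fX (unitModule X) U)
    (hc : ∀ j l m : ι, X.presheaf.map (homOfLE (inf_le_cechOpen_triple U j l m)).op (SecMod.toRing ρ (c ![j, l, m])) = s j l m) :
    ((Full.complex (sectionsSystem U (unitModule X) ρ)).d 2 3).hom c = 0 := by
  have hs' := (mem_cechMZ2_iff fX _ U s).1 hs
  refine full_d_eq_zero_of_raw_cocycle U ρ s c ((forall_toRing_eq_iff_forall_rawTwo_eq fX U ρ c s).2 hc) fun j l m n => ?_
  have h := congrFun (congrFun (congrFun (congrFun hs' j) l) m) n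
  rw [cechMD2_apply] at h
  simp only [MSections.res_unit, Sections.res_apply, Pi.zero_apply] at h
  exact h

/-- **`hc` convention**: the transport of a raw `2`-cocycle is a cocycle of `Full.complex S`. [cite: StacksProject, Tag 01FG] -/
theorem full_d_two_eq_zero_of_forall_toRing_eq_of_mem_cechMZ2 (c : Full.Cochain (sectionsSystem U (unitModule X) ρ) 2)
    (s : CechMC2 fX (unitModule X) U) (hs : s ∈ cechMZ2 fX (unitModule X) U)
    (hc : ∀ α : Fin (2 + 1) → ι, SecMod.toRing ρ (c α) =
      X.presheaf.map (homOfLE (cechOpen_image_le_inf₃ U α)).op (s (α 0) (α 1) (α 2))) :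
    ((Full.complex (sectionsSystem U (unitModule X) ρ)).d 2 3).hom c = 0 :=
  full_d_two_eq_zero_of_mem_cechMZ2 fX U ρ c s hs ((forall_toRing_eq_iff_forall_rawTwo_eq fX U ρ c s).1 hc)

/-- **Conversely, the raw reading of a cocycle of `Full.complex S` in degree `2` is a raw `2`-cocycle.** [cite: StacksProject, Tag 01FG] -/
theorem mem_cechMZ2_of_full_d_two_eq_zero (c : Full.Cochain (sectionsSystem U (unitModule X) ρ) 2)
    (hc : ((Full.complex (sectionsSystem U (unitModule X) ρ)).d 2 3).hom c = 0) :
    ((fun j l m => X.presheaf.map (homOfLE (inf_le_cechOpen_triple U j l m)).op (SecMod.toRing ρ (c ![j, l, m]))) :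
        CechMC2 fX (unitModule X) U) ∈ cechMZ2 fX (unitModule X) U := by
  refine (mem_cechMZ2_iff fX _ U _).2 (funext fun i => funext fun j => funext fun k => funext fun l => ?_)
  rw [cechMD2_apply]
  simp only [MSections.res_unit, Sections.res_apply, Pi.zero_apply]
  rw [resFun_comp, resFun_comp, resFun_comp, resFun_comp]
  -- the four faces of `U_i ∩ U_j ∩ U_k ∩ U_l` and `U_i ∩ U_j ∩ U_k ∩ U_l ⊆ U_{ {i,j,k,l} }`
  have hjkl : U i ⊓ U j ⊓ U k ⊓ U l ≤ U j ⊓ U k ⊓ U l :=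
    le_inf (le_inf (inf_le_left.trans (inf_le_left.trans inf_le_right)) (inf_le_left.trans inf_le_right)) inf_le_right
  have hikl : U i ⊓ U j ⊓ U k ⊓ U l ≤ U i ⊓ U k ⊓ U l :=
    le_inf (le_inf (inf_le_left.trans (inf_le_left.trans inf_le_left)) (inf_le_left.trans inf_le_right)) inf_le_right
  have hijl : U i ⊓ U j ⊓ U k ⊓ U l ≤ U i ⊓ U j ⊓ U l := le_inf (inf_le_left.trans inf_le_left) inf_le_right
  have hijk : U i ⊓ U j ⊓ U k ⊓ U l ≤ U i ⊓ U j ⊓ U k := inf_le_left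
  have hV : U i ⊓ U j ⊓ U k ⊓ U l ≤ cechOpen U (Finset.univ.image ![i, j, k, l]) :=
    le_cechOpen_image_of_forall U _ fun q => by
      fin_cases q
      · exact inf_le_left.trans (inf_le_left.trans inf_le_left)
      · exact inf_le_left.trans (inf_le_left.trans inf_le_right)
      · exact inf_le_left.trans inf_le_right
      · exact inf_le_right
  have hβ₀ : ((![i, j, k, l] : Fin (3 + 1) → ι) ∘ Fin.succAbove (0 : Fin (3 + 1))) = ![j, k, l] := by funext q; fin_cases q <;> rfl
  have hβ₁ : ((![i, j, k, l] : Fin (3 + 1) → ι) ∘ Fin.succAbove (1 : Fin (3 + 1))) = ![i, k, l] := by funext q; fin_cases q <;> rfl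
  have hβ₂ : ((![i, j, k, l] : Fin (3 + 1) → ι) ∘ Fin.succAbove (2 : Fin (3 + 1))) = ![i, j, l] := by funext q; fin_cases q <;> rfl
  have hβ₃ : ((![i, j, k, l] : Fin (3 + 1) → ι) ∘ Fin.succAbove (3 : Fin (3 + 1))) = ![i, j, k] := by funext q; fin_cases q <;> rfl
  have h := congrArg (fun x => X.presheaf.map (homOfLE hV).op (SecMod.toRing ρ x)) (congrFun hc ![i, j, k, l])
  dsimp only at h
  rw [Pi.zero_apply, SecMod.toRing_zero, map_zero] at h
  rw [map_toRing_d_two U ρ c _ hV (hV.trans (cechOpen_anti U (Full.image_comp_subset _ _)))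
      (hV.trans (cechOpen_anti U (Full.image_comp_subset _ _))) (hV.trans (cechOpen_anti U (Full.image_comp_subset _ _)))
      (hV.trans (cechOpen_anti U (Full.image_comp_subset _ _))),
    map_toRing_apply_congr U ρ c hβ₀ _ (hjkl.trans (inf_le_cechOpen_triple U j k l)),
    map_toRing_apply_congr U ρ c hβ₁ _ (hikl.trans (inf_le_cechOpen_triple U i k l)),
    map_toRing_apply_congr U ρ c hβ₂ _ (hijl.trans (inf_le_cechOpen_triple U i j l)),
    map_toRing_apply_congr U ρ c hβ₃ _ (hijk.trans (inf_le_cechOpen_triple U i j k))] at h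
  exact h

end Cocycle

end Literature.AlgebraicGeometry.Modules

end
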